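import Summits.QuantumFields.YangMills.Theorems.LuscherReductionTwistedTraceScalingBaseWindow
import HarnessLib

/-!
# S-TOWER of line «twolattice» (crux `TwistedTraceScaling`, stmt-QuantumFields-20203) REDUCED to the UNIFORM femto trace law
# `UTL` — and conversely `TOWER ∧ BASE ⇒ UTL`: the two-lattice comparison IS the `L`-uniform trace law (kernel-checked bookkeeping)

Route `LuscherReduction` (owner ym-beyond-p1), child crux `TwistedTraceScaling` (stmt-QuantumFields-20203), registered birth line
«twolattice» (`pub/ym-beyond/p1-g20-files/Lines-twolattice.lean`, sha16 a5c3dbcbf75f28d1).  Its load-bearing stub S-TOWER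

  `Stmt.stub_twoLatticeUniversality := ∀ s > 0, ∀ ε > 0, ∃ L0, ∃ lam0 > 0, ∀ lam ∈ (0, lam0], ∀ L₁ ≥ L0, ∀ L ≥ L₁, ∀ β ∈ W(lam, L),
     ∀ β₁ ≥ 1 with 1/ḡ²(β₁, L₁) = 1/ḡ²(β, L):  |traceRatio L β (femtoSteps s β L) − traceRatio L₁ β₁ (femtoSteps s β₁ L₁)| ≤ ε`

(two Wilson lattices at MATCHED two-loop running label have the same vacuum-free dyadic zero-flux trace ratio at femto-time `s`,
`L0` UNIFORM in `lam`) is compared here with the **uniform femto trace law**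

  `UTL := ∀ s > 0, ∀ ε > 0, ∃ L0, ∃ lam0 > 0, ∀ lam ∈ (0, lam0], ∀ L ≥ L0, ∀ β ∈ W(lam, L),
     |traceRatio L β (femtoSteps s β L) − hTraceRatio s| ≤ ε`

(the trace ratio tends to Lüscher's `r_𝔥(s)` deep in the window, with a threshold `L0` that does NOT depend on the depth `lam` —
S-BASE of the line is the same text at ONE lattice size with `β → ∞`, i.e. without the uniformity).  Results (sorry-free, standard axioms,
no definitions; hypotheses and conclusions are spelled-out texts, the conclusion of `twoLatticeUniversality_of_uniform` is VERBATIM the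
body of the registered `Stmt.stub_twoLatticeUniversality`):

* §1 matched labels: `1/ḡ²(β₁,L₁) = 1/ḡ²(β,L)` forces `Λ(β₁,L₁) = Λ(β,L)` (`luscherLambda` is a function of the label alone), hence the
  coarse pair lies in the SAME window `W(lam, L₁)` (`window_of_matched`); the label is continuous and unbounded in `β`, so matched
  couplings exist and are large (`exists_matched`, `matched_ge`) — adapted from the skeleton's §3 (owner g20) so that `Theorems/` has them.
* §2 ★ `twoLatticeUniversality_of_uniform : UTL → ⟨body of Stmt.stub_twoLatticeUniversality⟩` — triangle through `r_𝔥(s)`; both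
  lattices are served by the SAME `(L0, lam0)` of `UTL(s, ε/2)` because the coarse pair is in the same window.
* §3 ★ `uniform_of_twoLattice_of_base : ⟨S-TOWER body⟩ → ⟨S-BASE body⟩ → UTL` — conversely, TOWER at `ε/2` with base lattice
  `L₁ = max L0 1`, BASE there at `ε/2`, and the matched coupling (IVT) which is `≥ 1/(4 lam³)`; so modulo the fixed-lattice law BASE
  (sized «L», lane ym-luscher-20007-p1 / ym-20203-coarse-s1) S-TOWER and UTL are INTERCHANGEABLE: the two-lattice phrasing carries
  exactly the `L`-uniformity of the femto trace law and nothing else.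

Consequence for the line (lead ym-lead-20203-twolattice g0): S-TOWER closes by name from ANY proof of `UTL`
(`stub_twoLatticeUniversality := twoLatticeUniversality_of_uniform hUTL`), whether obtained by a lattice-to-lattice RG comparison
(strategy A; note that a block-spin map `(ℤ/L)³ → (ℤ/L₁)³` at fixed physical size needs `L₁ ∣ L`, so coprime pairs are reached only
through a common refinement `L·L₁` or through `r_𝔥`) or by `L`-uniform zero-mode control (strategy B, level currency: companion file
`…TwistedTraceScalingUniformOfCoarse.lean`).

HONEST FRAMING: a reduction; `UTL` is OPEN and is the RG / small-volume-continuum-limit content of the crux (not in print); femto rung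
R2b1 only; nothing here is infinite volume, a mass gap or Clay.  No definitions, no new named facts.
-/

set_option autoImplicit false

noncomputable section

open MeasureTheory Filter Topology Real
open scoped BigOperators

namespace Summit.QuantumFields.YangMills.Theorems.FemtoTransferGap.TwoLattice

open Summit.QuantumFields.YangMills.Theorems.FemtoTransferGap
open Summit.QuantumFields.YangMills.Theorems.FemtoTransferGap.TraceDoor
open Summit.QuantumFields.YangMills.Theorems.FemtoTransferGap.TT (physTrace)

namespace Tower

/-! ## §1 Matched labels: same `Λ`, same window; matched couplings exist and are large -/

/-- Lüscher's parameter is a function of the two-loop label alone: equal labels give equal `Λ`. [cite: LuscherMunster1984, §2] -/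
theorem luscherLambda_eq_of_matched {β β₁ : ℝ} {L L1 : ℕ}
    (h : invRunningCoupling β₁ L1 = invRunningCoupling β L) : luscherLambda β₁ L1 = luscherLambda β L := by
  unfold luscherLambda
  rw [h]

/-- **Same window.**  If `(L, β)` is in the femto window of depth `lam` and `β₁ ≥ 1` carries the same label on the lattice `L₁`, then
`(L₁, β₁)` is in the femto window of the same depth. [cite: LuscherMunster1984, §2] -/
theorem window_of_matched {lam β β₁ : ℝ} {L L1 : ℕ} (hW : InFemtoWindow lam β L) (hβ₁ : 1 ≤ β₁)
    (h : invRunningCoupling β₁ L1 = invRunningCoupling β L) : InFemtoWindow lam β₁ L1 := by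
  refine ⟨hβ₁, ?_, ?_⟩
  · rw [luscherLambda_eq_of_matched h]; exact hW.2.1
  · rw [luscherLambda_eq_of_matched h]; exact hW.2.2

/-- `β ↦ 1/ḡ²(β, L₁)` is continuous on every `[a, b]` with `a > 0`. [folklore] -/
theorem continuousOn_invRunningCoupling (L1 : ℕ) {a b : ℝ} (ha : 0 < a) :
    ContinuousOn (fun β : ℝ => invRunningCoupling β L1) (Set.Icc a b) := by
  -- adapted from the registered skeleton `Lines-twolattice.lean` §3 (owner ym-beyond-p1 g20)
  have h : (fun β : ℝ => invRunningCoupling β L1) =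
      fun β : ℝ => β / 2 - 2 * b0 * Real.log (L1 : ℝ) + (b1 / b0) * Real.log (2 * b0 / β) :=
    funext fun β => BOHandover.invRunningCoupling_eq β L1
  rw [h]
  refine ContinuousOn.add (ContinuousOn.sub (continuousOn_id.div_const 2) continuousOn_const)
    (ContinuousOn.mul continuousOn_const (ContinuousOn.log ?_ ?_))
  · exact continuousOn_const.div continuousOn_id fun x hx => (lt_of_lt_of_le ha hx.1).ne'
  · intro x hx
    have hx0 : 0 < x := lt_of_lt_of_le ha hx.1
    have hb0 : 0 < b0 := by unfold b0; positivity
    exact (div_pos (by positivity) hx0).ne'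

/-- **Matched couplings exist** (intermediate value theorem): every label value `v ≥ 1` is attained at some `β₁ ≥ 1` on the lattice
`L₁` (the label is `≤ 1/2` at `β = 1` and `≥ (19/242)β + const`). [folklore] -/
theorem exists_matched (L1 : ℕ) [NeZero L1] {v : ℝ} (hv : 1 ≤ v) :
    ∃ β₁ : ℝ, 1 ≤ β₁ ∧ invRunningCoupling β₁ L1 = v := by
  -- adapted from the registered skeleton `Lines-twolattice.lean` §3 (owner ym-beyond-p1 g20)
  set K : ℝ := b1 / b0 - 2 * b0 * Real.log (L1 : ℝ) with hK
  set βb : ℝ := max 1 ((v - K) * (242 / 19)) with hβb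
  have h1b : (1 : ℝ) ≤ βb := le_max_left _ _
  have hlo : invRunningCoupling 1 L1 ≤ v :=
    (BOHandover.invRunningCoupling_le_half le_rfl L1).trans (by linarith)
  have hhi : v ≤ invRunningCoupling βb L1 := by
    have hge := Base.invRunningCoupling_ge' (lt_of_lt_of_le one_pos h1b) L1
    have hb : (v - K) * (242 / 19) ≤ βb := le_max_right _ _
    have hb' : v - K ≤ βb * (19 / 242) := by linarith
    rw [← hK] at hge
    linarith
  have hcont := continuousOn_invRunningCoupling L1 (b := βb) one_pos
  obtain ⟨β₁, hmem, hval⟩ := intermediate_value_Icc h1b hcont ⟨hlo, hhi⟩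
  exact ⟨β₁, hmem.1, hval⟩

/-- **Matched couplings are large**: in a window of depth `lam ≤ 1/2` a matched `β₁ ≥ 1` satisfies `β₁ ≥ 1/(4 lam³)`
(`1/ḡ² ≥ 1/(8 lam³)` in the window and `1/ḡ²(β₁, L₁) ≤ β₁/2`). [folklore] -/
theorem matched_ge {lam β β₁ : ℝ} {L L1 : ℕ} [NeZero L1] (hlam : 0 < lam) (hW : InFemtoWindow lam β L) (hβ₁ : 1 ≤ β₁)
    (h : invRunningCoupling β₁ L1 = invRunningCoupling β L) : 1 / (4 * lam ^ 3) ≤ β₁ :=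
  BOHandover.beta_ge_of_window (L0 := L1) hlam (window_of_matched hW hβ₁ h)

/-- Threshold bookkeeping: `lam ≤ min(1, 1/(4M))` forces `M ≤ 1/(4 lam³)` (`M > 0`). [folklore] -/
theorem le_of_lam_small {lam M : ℝ} (hlam : 0 < lam) (h1 : lam ≤ 1) (hM : 0 < M) (hle : lam ≤ 1 / (4 * M)) :
    M ≤ 1 / (4 * lam ^ 3) := by
  -- adapted from the registered skeleton `Lines-twolattice.lean` §3 (owner ym-beyond-p1 g20)
  have hl3 : lam ^ 3 ≤ lam := pow_le_of_le_one hlam.le h1 three_ne_zero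
  have h4 : lam * (4 * M) ≤ 1 := by rwa [le_div_iff₀ (by positivity)] at hle
  rw [le_div_iff₀ (by positivity)]
  nlinarith [mul_le_mul_of_nonneg_left hl3 (by positivity : (0 : ℝ) ≤ 4 * M)]

/-- In a window of depth `lam ≤ 1/2` the label is at least `1`. [folklore] -/
theorem one_le_invRunningCoupling_of_window {lam β : ℝ} {L : ℕ} [NeZero L] (hlam : 0 < lam) (hhalf : lam ≤ 1 / 2)
    (hW : InFemtoWindow lam β L) : 1 ≤ invRunningCoupling β L := by
  have hl : 0 < luscherLambda β L := luscherLambda_pos_of_window hlam hW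
  have hv : 0 < invRunningCoupling β L := BOHandover.invRunningCoupling_pos_of_luscherLambda_pos hl
  have h3 : luscherLambda β L ^ 3 = (invRunningCoupling β L)⁻¹ := BOHandover.luscherLambda_pow_three hv
  have hle : luscherLambda β L ^ 3 ≤ (2 * lam) ^ 3 := pow_le_pow_left₀ hl.le hW.2.2 3
  have h8 : (2 * lam) ^ 3 ≤ 1 := by
    have : 2 * lam ≤ 1 := by linarith
    exact pow_le_one₀ (by positivity) this
  rw [h3] at hle
  have hinv : (invRunningCoupling β L)⁻¹ ≤ 1 := hle.trans h8
  rwa [inv_le_one₀ hv] at hinv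

/-! ## §2 ★ S-TOWER from the uniform femto trace law -/

/-- ★ **S-TOWER of line «twolattice» from the uniform femto trace law `UTL`** (conclusion = VERBATIM the body of the registered
`TwoLattice.Stmt.stub_twoLatticeUniversality`, skeleton sha16 a5c3dbcbf75f28d1): both lattices are within `ε/2` of `r_𝔥(s)` by
`UTL(s, ε/2)` — the coarse pair `(L₁, β₁)` is in the same window (`window_of_matched`) and `L₁ ≥ L0` — and the triangle inequality closes.
[cite: Luscher1983, §3] [cite: MontvayMunster1994, (3.145)] -/
theorem twoLatticeUniversality_of_uniform
    (hUTL : ∀ s : ℝ, 0 < s → ∀ ε : ℝ, 0 < ε → ∃ L0 : ℕ, ∃ lam0 : ℝ, 0 < lam0 ∧ ∀ lam : ℝ, 0 < lam → lam ≤ lam0 →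
      ∀ (L : ℕ) [NeZero L], L0 ≤ L → ∀ β : ℝ, InFemtoWindow lam β L →
        |traceRatio L β (femtoSteps s β L) - hTraceRatio s| ≤ ε) :
    ∀ s : ℝ, 0 < s → ∀ ε : ℝ, 0 < ε → ∃ L0 : ℕ, ∃ lam0 : ℝ, 0 < lam0 ∧ ∀ lam : ℝ, 0 < lam → lam ≤ lam0 →
      ∀ (L1 : ℕ) [NeZero L1], L0 ≤ L1 → ∀ (L : ℕ) [NeZero L], L1 ≤ L → ∀ β : ℝ, InFemtoWindow lam β L →
        ∀ β₁ : ℝ, 1 ≤ β₁ → invRunningCoupling β₁ L1 = invRunningCoupling β L →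
          |traceRatio L β (femtoSteps s β L) - traceRatio L1 β₁ (femtoSteps s β₁ L1)| ≤ ε := by
  intro s hs ε hε
  obtain ⟨L0, lam0, hlam0, H⟩ := hUTL s hs (ε / 2) (by positivity)
  refine ⟨L0, lam0, hlam0, ?_⟩
  intro lam hlam hle L1 _ hL1 L _ hL β hW β₁ hβ₁ hmatch
  have hfine := H lam hlam hle L (hL1.trans hL) β hW
  have hcoarse := H lam hlam hle L1 hL1 β₁ (window_of_matched hW hβ₁ hmatch)
  rw [abs_sub_comm] at hcoarse
  calc |traceRatio L β (femtoSteps s β L) - traceRatio L1 β₁ (femtoSteps s β₁ L1)|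
      = |(traceRatio L β (femtoSteps s β L) - hTraceRatio s) +
          (hTraceRatio s - traceRatio L1 β₁ (femtoSteps s β₁ L1))| := by congr 1; ring
    _ ≤ |traceRatio L β (femtoSteps s β L) - hTraceRatio s| +
          |hTraceRatio s - traceRatio L1 β₁ (femtoSteps s β₁ L1)| := abs_add_le _ _
    _ ≤ ε := by linarith

/-! ## §3 ★ Conversely: S-TOWER and S-BASE give the uniform femto trace law -/

/-- ★ **`UTL` from S-TOWER and S-BASE** (hypotheses = VERBATIM the bodies of the registered `Stmt.stub_twoLatticeUniversality` and
`Stmt.stub_fixedLatticeTraceLaw`): TOWER at `ε/2` gives a `lam`-uniform `L0` and a depth `lam0`; on the base lattice `L₁ = max L0 1`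
BASE at `ε/2` gives `β1`; for `lam ≤ min(lam0, 1/2, 1/(4 max(β1,1)))` every `(L, β)` in the window with `L ≥ L₁` has a matched
`β₁ ≥ 1` on `L₁` (IVT, `exists_matched`), which is `≥ 1/(4lam³) ≥ β1` (`matched_ge`); triangle through `r(L₁, β₁, T₁)`.  So, given
the fixed-lattice law, the two-lattice universality statement and the `L`-uniform trace law are the same mathematics.
[cite: Luscher1983, §3] [cite: MontvayMunster1994, (3.145)] -/
theorem uniform_of_twoLattice_of_base
    (hTOWER : ∀ s : ℝ, 0 < s → ∀ ε : ℝ, 0 < ε → ∃ L0 : ℕ, ∃ lam0 : ℝ, 0 < lam0 ∧ ∀ lam : ℝ, 0 < lam → lam ≤ lam0 →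
      ∀ (L1 : ℕ) [NeZero L1], L0 ≤ L1 → ∀ (L : ℕ) [NeZero L], L1 ≤ L → ∀ β : ℝ, InFemtoWindow lam β L →
        ∀ β₁ : ℝ, 1 ≤ β₁ → invRunningCoupling β₁ L1 = invRunningCoupling β L →
          |traceRatio L β (femtoSteps s β L) - traceRatio L1 β₁ (femtoSteps s β₁ L1)| ≤ ε)
    (hBASE : ∀ (L1 : ℕ) [NeZero L1] (s : ℝ), 0 < s → ∀ ε : ℝ, 0 < ε → ∃ β1 : ℝ, ∀ β : ℝ, β1 ≤ β →
      |traceRatio L1 β (femtoSteps s β L1) - hTraceRatio s| ≤ ε) :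
    ∀ s : ℝ, 0 < s → ∀ ε : ℝ, 0 < ε → ∃ L0 : ℕ, ∃ lam0 : ℝ, 0 < lam0 ∧ ∀ lam : ℝ, 0 < lam → lam ≤ lam0 →
      ∀ (L : ℕ) [NeZero L], L0 ≤ L → ∀ β : ℝ, InFemtoWindow lam β L →
        |traceRatio L β (femtoSteps s β L) - hTraceRatio s| ≤ ε := by
  intro s hs ε hε
  have hε2 : 0 < ε / 2 := by positivity
  obtain ⟨L0T, lam0T, hlam0T, hT⟩ := hTOWER s hs (ε / 2) hε2
  haveI hL1 : NeZero (max L0T 1) := ⟨Nat.one_le_iff_ne_zero.mp (le_max_right _ _)⟩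
  obtain ⟨β1, hB⟩ := hBASE (max L0T 1) s hs (ε / 2) hε2
  set M : ℝ := max β1 1 with hM
  have hM1 : 1 ≤ M := le_max_right _ _
  have hMpos : 0 < M := lt_of_lt_of_le one_pos hM1
  refine ⟨max L0T 1, min (min lam0T (1 / 2)) (1 / (4 * M)), lt_min (lt_min hlam0T (by norm_num)) (by positivity), ?_⟩
  intro lam hlam hlamle L _ hL β hW
  have hlam0T' : lam ≤ lam0T := hlamle.trans ((min_le_left _ _).trans (min_le_left _ _))
  have hlamhalf : lam ≤ 1 / 2 := hlamle.trans ((min_le_left _ _).trans (min_le_right _ _))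
  have hlamM : lam ≤ 1 / (4 * M) := hlamle.trans (min_le_right _ _)
  have hlam1 : lam ≤ 1 := by linarith
  -- the matched coarse coupling on the base lattice exists and is large
  obtain ⟨β₁, hβ₁1, hmatch⟩ :=
    exists_matched (max L0T 1) (v := invRunningCoupling β L) (one_le_invRunningCoupling_of_window hlam hlamhalf hW)
  have hβ₁ge : β1 ≤ β₁ :=
    ((le_max_left _ _).trans (le_of_lam_small hlam hlam1 hMpos hlamM)).trans (matched_ge hlam hW hβ₁1 hmatch)
  have hTow := hT lam hlam hlam0T' (max L0T 1) (le_max_left _ _) L hL β hW β₁ hβ₁1 hmatch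
  have hBas := hB β₁ hβ₁ge
  calc |traceRatio L β (femtoSteps s β L) - hTraceRatio s|
      = |(traceRatio L β (femtoSteps s β L) - traceRatio (max L0T 1) β₁ (femtoSteps s β₁ (max L0T 1))) +
          (traceRatio (max L0T 1) β₁ (femtoSteps s β₁ (max L0T 1)) - hTraceRatio s)| := by congr 1; ring
    _ ≤ |traceRatio L β (femtoSteps s β L) - traceRatio (max L0T 1) β₁ (femtoSteps s β₁ (max L0T 1))| +
          |traceRatio (max L0T 1) β₁ (femtoSteps s β₁ (max L0T 1)) - hTraceRatio s| := abs_add_le _ _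
    _ ≤ ε := by linarith

end Tower

end Summit.QuantumFields.YangMills.Theorems.FemtoTransferGap.TwoLattice

end
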